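import Mathlib
import Summits.ValiantsHypothesis.ValiantsHypothesis.Theorems.DivisionGapPerCofactorDegreeReductionStubMemberDescent
import Summits.ValiantsHypothesis.ValiantsHypothesis.Theorems.DivisionGapPerDivisionHardStubJssContraction
import Literature.Computability.AlgebraicComplexity.ArithCircuitProofs

/-!
# `DivisionGap.PerCofactorDegreeReduction` (stmt-ValiantsHypothesis-15046), line `Sketch_ideator4`
(idea intrinsic-member-descent): the isolated strip (stub `stub_isolatedStrip`, F1)

If a monomial `u` of the multiplier `h` (over `ℝ≥0`) is the ONLY monomial of `h` supported
inside a cell set `G ⊇ supp u`, then the face permanent `per_G = facePer G` is polynomially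
bounded by `s = L(per_n · h)`:

* member descent (`MemberDescent.stub_memberDescent`): `L(per_G · h|_G) ≤ s`, and under the
  isolation hypotheses the `G`-member part `h|_G` of `h` is the single term `c · x^u`,
  `c = coeff_u h ≠ 0`;
* unscaling costs one gate (`complexity_smul_le_holds`): `per_G · (c x^u) = c • (x^u · per_G)`,
  so `L(x^u · per_G) = L(c⁻¹ • (c • (x^u · per_G))) ≤ s + 1`;
* the Jukna–Seiwert–Sergeev contraction (`stub_jssContraction`):
  `L(per_G) ≤ ((n+2)(L(x^u · per_G)+2))^κ ≤ ((n+2)(s+3))^κ`.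

No definitions in this file. [folklore]
-/

noncomputable section

-- `Summit.ValiantsHypothesis.ValiantsHypothesis.…` is the tree's mandated single-conjunct layout
-- (Sub = Summit), so the duplicated namespace component is intended.
set_option linter.dupNamespace false

open MvPolynomial Literature.Computability.AlgebraicComplexity
open Summit.ValiantsHypothesis.ValiantsHypothesis.Theorems.DivisionGapPerDivisionHard (facePer)
open scoped NNReal

namespace Summit.ValiantsHypothesis.ValiantsHypothesis.Theorems.DivisionGap.PerCofactorDegreeReduction.IsolatedStrip

variable {n : ℕ}

/-- Under the isolation hypotheses (`u ∈ supp h`, `supp u ⊆ G`, and `u` is the only monomial of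
`h` supported inside `G`) the `G`-member part of `h` is the single term `coeff_u h · x^u`.
[folklore] -/
theorem memberPart_eq_monomial (h : MvPolynomial (Fin n × Fin n) ℝ≥0)
    (u : (Fin n × Fin n) →₀ ℕ) (G : Finset (Fin n × Fin n))
    (hu : u ∈ h.support) (huG : u.support ⊆ G)
    (hiso : ∀ v ∈ h.support, v.support ⊆ G → v = u) :
    ∑ v ∈ h.support.filter (fun v => v.support ⊆ G), monomial v (coeff v h) =
      monomial u (coeff u h) := by
  have hfilter : h.support.filter (fun v => v.support ⊆ G) = {u} := by
    refine Finset.eq_singleton_iff_unique_mem.2 ⟨?_, ?_⟩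
    · exact Finset.mem_filter.2 ⟨hu, huG⟩
    · intro v hv
      obtain ⟨hv, hvG⟩ := Finset.mem_filter.1 hv
      exact hiso v hv hvG
  rw [hfilter, Finset.sum_singleton]

/-- Unscaling a nonzero scalar costs at most one gate: `L(f) ≤ L(c • f) + 1` for `c ≠ 0`,
since `f = c⁻¹ • (c • f)` (`complexity_smul_le_holds`). [folklore] -/
theorem complexity_le_complexity_smul_add_one {c : ℝ≥0} (hc : c ≠ 0)
    (f : MvPolynomial (Fin n × Fin n) ℝ≥0) :
    complexity f ≤ complexity (c • f) + 1 := by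
  have key := complexity_smul_le_holds (k := ℝ≥0) (σ := Fin n × Fin n) c⁻¹ (c • f)
  rwa [inv_smul_smul₀ hc] at key

/-- From member descent under isolation: `L(x^u · per_G) ≤ L(per_n · h) + 1`. [folklore] -/
theorem complexity_monomial_mul_facePer_le (h : MvPolynomial (Fin n × Fin n) ℝ≥0)
    (u : (Fin n × Fin n) →₀ ℕ) (G : Finset (Fin n × Fin n))
    (hu : u ∈ h.support) (huG : u.support ⊆ G)
    (hiso : ∀ v ∈ h.support, v.support ⊆ G → v = u) :
    complexity (monomial u (1 : ℝ≥0) * facePer G) ≤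
      complexity (perPoly (Fin n) ℝ≥0 * h) + 1 := by
  have hc : coeff u h ≠ 0 := mem_support_iff.1 hu
  have hmd := MemberDescent.stub_memberDescent n h G
  rw [memberPart_eq_monomial h u G hu huG hiso] at hmd
  have hfac : facePer G * monomial u (coeff u h) =
      coeff u h • (monomial u (1 : ℝ≥0) * facePer G) := by
    rw [mul_comm, ← smul_mul_assoc, smul_monomial, smul_eq_mul, mul_one]
  rw [hfac] at hmd
  exact (complexity_le_complexity_smul_add_one hc _).trans (Nat.add_le_add_right hmd 1)

/-- **Isolated strip (stub `stub_isolatedStrip`, F1, of line `Sketch_ideator4`).**  If some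
monomial `u` of `h` is the ONLY monomial of `h` supported inside a cell set `G ⊇ supp u`, then
the face permanent of `G` is polynomially bounded by `L(per_n · h)`: member descent
(`MemberDescent.stub_memberDescent`) gives `L(per_G · coeff_u h x^u) ≤ L(per_n · h)`, unscaling
costs one gate (`complexity_smul_le_holds`), and the Jukna–Seiwert–Sergeev contraction
(`stub_jssContraction`: `L(f) ≤ ((n+2)(L(x^u f)+2))^κ`) strips `x^u`, whence
`L(per_G) ≤ ((n+2)(L(per_n · h)+3))^κ`. [folklore] -/
theorem stub_isolatedStrip :
    ∃ k : ℕ, ∀ (n : ℕ) (h : MvPolynomial (Fin n × Fin n) ℝ≥0)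
      (u : (Fin n × Fin n) →₀ ℕ) (G : Finset (Fin n × Fin n)),
      u ∈ h.support → u.support ⊆ G →
      (∀ v ∈ h.support, v.support ⊆ G → v = u) →
      complexity (facePer G) ≤ ((n + 2) * (complexity (perPoly (Fin n) ℝ≥0 * h) + 3)) ^ k := by
  obtain ⟨κ, hκ⟩ := DivisionGapPerDivisionHard.stub_jssContraction
  refine ⟨κ, fun n h u G hu huG hiso => ?_⟩
  refine (hκ n (facePer G) u).trans (Nat.pow_le_pow_left (Nat.mul_le_mul_left _ ?_) κ)
  have := complexity_monomial_mul_facePer_le h u G hu huG hiso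
  omega

end Summit.ValiantsHypothesis.ValiantsHypothesis.Theorems.DivisionGap.PerCofactorDegreeReduction.IsolatedStrip

end
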